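import Literature.Computability.Complexity.CfgCodes
import HarnessLib

/-!
# Configuration codes, II: popping all stacks, reading the header, initial codes, and the
# standard machine along total runs

Sequel of `CfgCodes.lean` (configurations of a standard machine `c : TM2Std.SCode` as words
over the block alphabet `CfgCodes.Blk c`; the step transducer `CfgCodes.stepT` realises the
total step `TM2Sim.stepTotal` on codes, `CfgCodes.stepT_eval_encCfg`). A clocked simulation
that must READ OFF a cell of the simulated configuration at an arbitrary depth `i` (the
"snapshots" `zᵢ` of Arora–Barak 2009, proof of Thm. 6.20; the blocks of a tableau row, Sipser
2012, proof of Thm. 9.30) cannot do so with one finite-state pass (the depth is unbounded), but it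
can POP every stack `i` times and then read the tops, which sit in the header block. This file
supplies these two passes and the bookkeeping around them:

* `CfgCodes.popT c := passT c (popΦ c)` — the transducer popping every stack once
  (`popΦ x = ⟨x.l, x.var, fun k => (x.stk k).drop 1⟩`); `popT_eval_encCfg`,
  `iterate_popT_eval_encCfg` (`n` passes drop `n` symbols from every stack);
* `CfgCodes.hdrT c g` — the transducer that reads the FIRST block and, if it is a header
  `hdr l v w`, outputs the word `g l v w` (any output alphabet), discarding everything else;
  `hdrT_eval_cons`, `hdrT_eval_encCfg` (on a code it outputs `g x.l x.var (toWin x.stk)`, i.e. a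
  finite function of the label, the state and the top-`D` windows);
* `CfgCodes.initBlocks c y` — the pre-code of Mathlib's initial configuration `initList c.tm y`
  (a fixed header, `nK` separators, then the input symbols) and `normT_eval_initBlocks`:
  the normaliser `normT` turns it into `encCfg (initList c.tm y)`;
* `TM2Std.trCfg_stepTotal`, `TM2Std.trCfg_iterate_stepTotal`, `TM2Std.stkOK_iterate_stepTotal` —
  the standard machine `TM2Std.stdCode tm` of an arbitrary `tm : FinTM2` (`PolyTimeCountable.lean`,
  one-step simulation `TM2Std.step_tr`) follows the TOTAL run `stepTotal^[n]` of `tm` on coded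
  configurations (`TM2Std.trCfg`), idling with it after halting; `TM2Std.getElem?_trCfg_stk`
  reads a cell of the coded configuration.

## References

* S. Arora, B. Barak, *Computational Complexity: A Modern Approach*, CUP 2009, §1.4 and proof of
  Thm. 1.9 (universal simulation: the simulated configuration as a string), proof of Thm. 6.20
  (snapshots `zᵢ` of an exponential-time computation). [AroraBarakCC2009]
* M. Sipser, *Introduction to the Theory of Computation*, 3rd ed., Cengage 2012, proof of
  Thm. 9.30 (rows and cells of a tableau). [Sipser2012]
-/

noncomputable section

namespace Literature.Computability.Complexity

open Turing

namespace CfgCodes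

open TM2Std TM2Sim

variable (c : SCode)

/-! ### Popping every stack once -/

/-- The configuration map "pop every stack once" (label and state unchanged). [folklore] -/
def popΦ (x : c.tm.Cfg) : c.tm.Cfg := ⟨x.l, x.var, fun k => (x.stk k).drop 1⟩

/-- **The popping transducer**: `passT` of `popΦ`. [cite: AroraBarakCC2009, §1.4] -/
def popT : FST (St c) (Blk c) (Blk c) := passT c (popΦ c)

/-- `popΦ` shortens stacks, so it maps truncated configurations to stacks of length `≤ 2D`.
[folklore] -/
theorem length_popΦ_stk_le (x : c.tm.Cfg) (hx : ∀ k, (x.stk k).length ≤ D c) (k : Fin c.nK) :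
    ((popΦ c x).stk k).length ≤ 2 * D c := by
  have h := hx k
  simp only [popΦ, List.length_drop]
  omega

/-- Splitting a stack at the window and popping inside the window is popping. [folklore] -/
theorem drop_one_take_append_drop {α : Type} {d : ℕ} (hd : 1 ≤ d) (L : List α) :
    (L.take d).drop 1 ++ L.drop d = L.drop 1 := by
  rw [List.drop_take]
  obtain ⟨d, rfl⟩ : ∃ d', d = d' + 1 := ⟨d - 1, by omega⟩
  rw [Nat.add_sub_cancel, show d + 1 = 1 + d from Nat.add_comm _ _, ← List.drop_drop, List.take_append_drop]

/-- **The popping transducer pops every stack of a code once.** [cite: AroraBarakCC2009, §1.4] -/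
theorem popT_eval_encCfg (x : c.tm.Cfg) :
    (popT c).eval (encCfg c x) = encCfg c (popΦ c x) := by
  have hpre : encCfg c x = preEnc c x.l x.var (fun k => (x.stk k).take (D c)) fun k => (x.stk k).drop (D c) := by
    rw [encCfg, preEnc, preEnc, toWin_take]
  rw [popT, hpre, passT_eval_preEnc c _ (length_popΦ_stk_le c) _ _ _ _ (fun k => List.length_take_le _ _)]
  simp only [popΦ]
  congr 2
  funext k
  exact drop_one_take_append_drop (one_le_D c) (x.stk k)

/-- **`n` popping passes drop `n` symbols from every stack.** [cite: AroraBarakCC2009, §1.4] -/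
theorem iterate_popT_eval_encCfg (x : c.tm.Cfg) (n : ℕ) :
    (popT c).eval^[n] (encCfg c x) = encCfg c ⟨x.l, x.var, fun k => (x.stk k).drop n⟩ := by
  induction n generalizing x with
  | zero => obtain ⟨l, v, S⟩ := x; simp
  | succ n ih =>
    rw [Function.iterate_succ_apply, popT_eval_encCfg, ih]
    simp only [popΦ, List.drop_drop]
    congr 2
    funext k
    rw [Nat.add_comm 1 n]

/-! ### Reading the header -/

section Header

variable {Γ₁ : Type} (g : Option (Fin c.nΛ) → Fin c.nσ → Win c → List Γ₁)

/-- States of the header reader: nothing read yet (`none`), the first block was not a header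
(`some none`), or the header read (`some (some (l, v, w))`). [folklore] -/
abbrev HdrSt : Type := Option (Option (Option (Fin c.nΛ) × Fin c.nσ × Win c))

/-- Transition of the header reader: only the first block matters. [folklore] -/
def hdrStep : HdrSt c → Blk c → HdrSt c × List Γ₁
  | none, Blk.hdr l v w => (some (some (l, v, w)), [])
  | none, _ => (some none, [])
  | some t, _ => (some t, [])

/-- The word output by the header reader in its final state. [folklore] -/
def hdrFront : HdrSt c → List Γ₁
  | some (some (l, v, w)) => g l v w
  | _ => []

/-- **The header reader**: reads the first block of a code and outputs `g l v w` for a header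
`hdr l v w` — a finite function of the label, the state and the top-`D` windows of the coded
configuration; the rest of the code is discarded (`keep = false`).
[cite: AroraBarakCC2009, Thm. 6.20 (proof: reading a snapshot)] -/
def hdrT : FST (HdrSt c) (Blk c) Γ₁ where
  init := none
  step := hdrStep c
  front := hdrFront c g
  keep := fun _ => false

variable {c g}

/-- Once the first block has been read the state is frozen. [folklore] -/
theorem hdrT_run_some (t : Option (Option (Fin c.nΛ) × Fin c.nσ × Win c)) :
    ∀ rest : List (Blk c), ((hdrT c g).run (some t) rest).1 = some t := by
  intro rest
  induction rest with
  | nil => rfl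
  | cons a rest ih => rw [FST.run_cons]; exact ih

/-- **The header reader on a word starting with a header.** [folklore] -/
theorem hdrT_eval_cons (l : Option (Fin c.nΛ)) (v : Fin c.nσ) (w : Win c) (rest : List (Blk c)) :
    (hdrT c g).eval (Blk.hdr l v w :: rest) = g l v w := by
  have h1 : ((hdrT c g).run (hdrT c g).init (Blk.hdr l v w :: rest)).1 = some (some (l, v, w)) := by
    rw [FST.run_cons]
    exact hdrT_run_some (some (l, v, w)) rest
  rw [FST.eval, h1]
  simp [hdrT, hdrFront]

/-- **The header reader on the code of a configuration** outputs `g x.l x.var (toWin x.stk)`.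
[cite: AroraBarakCC2009, Thm. 6.20 (proof: reading a snapshot)] -/
theorem hdrT_eval_encCfg (x : c.tm.Cfg) :
    (hdrT c g).eval (encCfg c x) = g x.l x.var (toWin c x.stk) := by
  rw [encCfg_eq, hdrT_eval_cons]

/-- The possible outputs of the header reader. [folklore] -/
theorem hdrFront_eq_or (s : HdrSt c) : (∃ l v w, hdrFront c g s = g l v w) ∨ hdrFront c g s = [] := by
  rcases s with _ | _ | ⟨l, v, w⟩
  · exact Or.inr rfl
  · exact Or.inr rfl
  · exact Or.inl ⟨l, v, w, rfl⟩

/-- The header reader outputs its front word only. [folklore] -/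
theorem hdrT_eval_eq (u : List (Blk c)) : (hdrT c g).eval u = hdrFront c g ((hdrT c g).run none u).1 := by
  rw [FST.eval]
  have hk : ∀ s, (hdrT c g).keep s = false := fun _ => rfl
  simp only [hk, Bool.false_eq_true, ↓reduceIte, List.append_nil]
  rfl

/-- The header reader's output is one of the finitely many words `g l v w` (or empty), on every
input. [folklore] -/
theorem hdrT_eval_eq_or (u : List (Blk c)) :
    (∃ l v w, (hdrT c g).eval u = g l v w) ∨ (hdrT c g).eval u = [] := by
  rw [hdrT_eval_eq]
  exact hdrFront_eq_or _

end Header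

/-- The depth-`0` entries of the window are the tops of the stacks. [folklore] -/
theorem toWin_zero (S : Fin c.nK → List (Sym c)) (k : Fin c.nK) :
    toWin c S k ⟨0, one_le_D c⟩ = (S k)[0]? := rfl

/-! ### Codes of initial configurations -/

/-- **The blocks of an initial configuration before normalisation**: the header with the main
label, the initial state and empty windows, `nK` separators (all stacks but the input stack are
empty and the input stack is written last), then the input symbols. [cite: AroraBarakCC2009, §1.4] -/
def initBlocks (y : List (Sym c)) : List (Blk c) :=
  Blk.hdr (some c.main) c.init (toWin c fun _ => []) :: (List.replicate c.nK Blk.sep ++ y.map Blk.sym)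

/-- `initBlocks y` is the pre-code with empty windows of the initial stack assignment. [folklore] -/
theorem initBlocks_eq_preEnc (y : List (Sym c)) :
    initBlocks c y = preEnc c (some c.main) c.init (fun _ => []) (Function.update (fun _ => []) c.k₀ y) := by
  rw [initBlocks, preEnc, bodyOf_update_k₀]

/-- **The normaliser turns `initBlocks y` into the code of the initial configuration on `y`.**
[cite: AroraBarakCC2009, §1.4 (the initial configuration as a string)] -/
theorem normT_eval_initBlocks (y : List (Sym c)) :
    (normT c).eval (initBlocks c y) = encCfg c (initList c.tm y) := by
  rw [initBlocks_eq_preEnc, normT_eval_preEnc_nil, TM2Comp.initList_eq]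

/-- `initBlocks` is a fixed block followed by a letter-to-letter image of the input. [folklore] -/
theorem initBlocks_eq_append (y : List (Sym c)) :
    initBlocks c y = (Blk.hdr (some c.main) c.init (toWin c fun _ => []) :: List.replicate c.nK Blk.sep) ++
      y.flatMap fun g => [Blk.sym g] := by
  rw [initBlocks, List.cons_append, List.map_eq_flatMap]

/-! ### Sizes of codes along a run -/

/-- The code of configuration `t` of a run from an input of length `n` has at most
`1 + nK + nK · (n + depth · t)` blocks. [folklore] -/
theorem length_encCfg_iterate_initList_le (y : List (Sym c)) (t : ℕ) :
    (encCfg c ((stepTotal c.tm)^[t] (initList c.tm y))).length ≤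
      1 + c.nK + c.nK * (y.length + depth c.tm * t) := by
  refine (length_encCfg_le c _).trans ?_
  have h : ∀ k, (((stepTotal c.tm)^[t] (initList c.tm y)).stk k).length ≤ y.length + depth c.tm * t := by
    intro k
    have h1 := length_iterate_stepTotal_le c.tm (initList c.tm y) k t
    have h2 : ((initList c.tm y).stk k).length ≤ y.length := by
      rw [TM2Comp.initList_eq]
      dsimp only
      by_cases hk : k = c.k₀
      · subst hk; rw [Function.update_self]
      · rw [Function.update_of_ne hk]; exact Nat.zero_le _
    omega
  have hs : ∑ k : Fin c.nK, (((stepTotal c.tm)^[t] (initList c.tm y)).stk k).length ≤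
      ∑ _k : Fin c.nK, (y.length + depth c.tm * t) := Finset.sum_le_sum fun k _ => h k
  rw [Finset.sum_const, Finset.card_univ, Fintype.card_fin, smul_eq_mul] at hs
  exact Nat.add_le_add_left hs _

/-- Popping only shortens codes' stacks: the code of `⟨l, v, S.drop n⟩` is at most as long as
`1 + nK + Σ |S k|`. [folklore] -/
theorem length_encCfg_drop_le (x : c.tm.Cfg) (n : ℕ) :
    (encCfg c ⟨x.l, x.var, fun k => (x.stk k).drop n⟩).length ≤ 1 + c.nK + ∑ k, (x.stk k).length := by
  refine (length_encCfg_le c _).trans ?_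
  have : ∑ k : Fin c.nK, ((x.stk k).drop n).length ≤ ∑ k, (x.stk k).length :=
    Finset.sum_le_sum fun k _ => by simp
  simpa using this

end CfgCodes

/-! ### The standard machine along total runs -/

namespace TM2Std

open TM2Sim

variable (tm : FinTM2)

/-- The label of a coded configuration. [folklore] -/
theorem trCfg_l (x : tm.Cfg) : (trCfg tm x).l = x.l.map (eΛ tm) := rfl

/-- The state of a coded configuration. [folklore] -/
theorem trCfg_var (x : tm.Cfg) : (trCfg tm x).var = eσ tm x.var := rfl

/-- The stacks of a coded configuration are the coded stacks. [folklore] -/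
theorem trCfg_stk (x : tm.Cfg) (k : tm.K) :
    (trCfg tm x).stk (eK tm k) = (x.stk k).map fun γ => enc tm ⟨k, γ⟩ :=
  trStk_apply tm x.stk k

/-- Reading a cell of a coded configuration. [folklore] -/
theorem getElem?_trCfg_stk (x : tm.Cfg) (k : tm.K) (i : ℕ) :
    ((trCfg tm x).stk (eK tm k))[i]? = ((x.stk k)[i]?).map fun γ => enc tm ⟨k, γ⟩ := by
  rw [trCfg_stk, List.getElem?_map]

/-- Lengths of coded stacks. [folklore] -/
theorem length_trCfg_stk (x : tm.Cfg) (k : tm.K) :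
    ((trCfg tm x).stk (eK tm k)).length = (x.stk k).length := by
  rw [trCfg_stk, List.length_map]

/-- Allowed symbols stay allowed under a total step. [folklore] -/
theorem stkOK_stepTotal {x : tm.Cfg} (hx : StkOK tm x.stk) : StkOK tm (stepTotal tm x).stk := by
  cases hl : x.l with
  | none => rw [stepTotal_of_none tm hl]; exact hx
  | some l => exact (step_tr tm x (stepTotal tm x) hx (step_eq_of_some tm hl)).2

/-- Allowed symbols stay allowed along a total run. [folklore] -/
theorem stkOK_iterate_stepTotal {x : tm.Cfg} (hx : StkOK tm x.stk) (n : ℕ) :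
    StkOK tm ((stepTotal tm)^[n] x).stk := by
  induction n with
  | zero => exact hx
  | succ n ih => rw [Function.iterate_succ_apply']; exact stkOK_stepTotal tm ih

/-- **The standard machine follows one total step**: on a configuration with allowed symbols,
`trCfg (stepTotal x) = stepTotal (trCfg x)` (a halted configuration is coded by a halted one).
[cite: AroraBarakCC2009, §1.4] -/
theorem trCfg_stepTotal {x : tm.Cfg} (hx : StkOK tm x.stk) :
    trCfg tm (stepTotal tm x) = stepTotal (stdCode tm).tm (trCfg tm x) := by
  cases hl : x.l with
  | none =>
    have hl' : (trCfg tm x).l = none := by rw [trCfg_l, hl]; rfl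
    rw [stepTotal_of_none tm hl, stepTotal_of_none _ hl']
  | some l =>
    have hl' : (trCfg tm x).l = some (eΛ tm l) := by rw [trCfg_l, hl]; rfl
    have h1 := (step_tr tm x (stepTotal tm x) hx (step_eq_of_some tm hl)).1
    rw [step_eq_of_some _ hl'] at h1
    exact (Option.some.inj h1).symm

/-- **The standard machine follows total runs.** [cite: AroraBarakCC2009, §1.4] -/
theorem trCfg_iterate_stepTotal {x : tm.Cfg} (hx : StkOK tm x.stk) (n : ℕ) :
    trCfg tm ((stepTotal tm)^[n] x) = (stepTotal (stdCode tm).tm)^[n] (trCfg tm x) := by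
  induction n with
  | zero => rfl
  | succ n ih =>
    rw [Function.iterate_succ_apply', Function.iterate_succ_apply',
      trCfg_stepTotal tm (stkOK_iterate_stepTotal tm hx n), ih]

/-- In particular for runs from an input word: configuration `t` of the standard machine on the
coded input is the code of configuration `t` of `tm`. [cite: AroraBarakCC2009, §1.4] -/
theorem iterate_stepTotal_initList_stkCode (L : List (tm.Γ tm.k₀)) (t : ℕ) :
    (stepTotal (stdCode tm).tm)^[t] (initList (stdCode tm).tm (stkCode tm tm.k₀ L)) =
      trCfg tm ((stepTotal tm)^[t] (initList tm L)) := by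
  rw [trCfg_iterate_stepTotal tm (stkOK_initList tm L), trCfg_initList]

/-- A symbol occurring in a run from an input word is allowed. [folklore] -/
theorem allowed_of_getElem?_iterate (L : List (tm.Γ tm.k₀)) (t : ℕ) (k : tm.K) {i : ℕ} {γ : tm.Γ k}
    (h : (((stepTotal tm)^[t] (initList tm L)).stk k)[i]? = some γ) :
    (⟨k, γ⟩ : Σ k, tm.Γ k) ∈ allowed tm :=
  stkOK_iterate_stepTotal tm (stkOK_initList tm L) t k γ (List.mem_of_getElem? h)

end TM2Std

end Literature.Computability.Complexity

end
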